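import Mathlib
import Summits.NavierStokesRegularity.NavierStokesRegularity.Theorems.SubOnsagerCeilingGapChain21
import Summits.NavierStokesRegularity.NavierStokesRegularity.Theorems.SubOnsagerCeilingDyadicTailCeilingLargeRatio
import Summits.NavierStokesRegularity.NavierStokesRegularity.Theorems.OrthantWakeDyadicBreakBelowOneGeNineTwentyFifths
import Summits.NavierStokesRegularity.NavierStokesRegularity.Theorems.SubOnsagerCeilingKPRelabel
import HarnessLib

/-!
# The one-mode consequences of the chain descent to `b = 5/4` (hands 4-g20 / 4-g21, RUNGS 19–29), BY NAME:
# `DyadicTailCeiling` (stmt-25511) at every `ε₀ ∈ [1/4, 1]`, `OrthantWake.DyadicBreakBelowOne` (stmt-24644) on `[1/4, 1)`,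
# and the Katz–Pavlović chain on ANY component at every `ε₀ ∈ [1/4, 1]`
(helper file, def-free; `--supports` the crux `SubOnsagerCeiling.ForwardTailCeilingKP`, stmt-NavierStokesRegularity-27057;
hand leafhand-ns-subonsagerceiling-4 gen 22)

The landed certificate range of the ν-uniform shell barrier for scaled dyadic tables (`θ = 101/200`, `D = 100`) is now
`dyadicGapRange21Wide_shellBarrierAt`: EVERY `ε₀ ∈ [1/4, 1]`, i.e. every scale ratio `b ∈ [5/4, 2]` — the whole ratio range of the
registered stub `stub_primaryGradedLargeRatio`.  The one-mode corollaries recorded at the older range `[9/25, 1]` are re-issued here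
at `[1/4, 1]` through the same interval-free adapters (no new mathematics):

* `dyadicTailCeilingAt_quarterRatio` — the body of the route decl `SubOnsagerCeiling.DyadicTailCeiling` (item 25511) at EVERY
  `ε₀ ∈ [1/4, 1]` (adapter `dyadicTailCeilingAt_of_shellBarrierAt`; supersedes `dyadicTailCeilingAt_largeRatio`, `[9/25, 1]`);
* `dyadicTailCeiling_of_belowQuarter` — WHAT IS LEFT of item 25511 by name: its small-ratio part `ε₀ ∈ (0, 1/4)` alone — exactly
  the ratio range of the registered stub `stub_primaryGradedSmallRatio` of crux 27057 (supersedes `dyadicTailCeiling_of_smallRatio`);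
* `not_noGlobalCascade_dyadicTable_of_ge_quarter`, `dyadicBreakBelowOne_of_ge_quarter` — item 24644 (`OrthantWake.DyadicBreakBelowOne`:
  no Theorem-4.2 blow-up for the dyadic member) on `[1/4, 1)` (adapter `dyadicBreakBelowOne_on_of_shellBarrierAt`; supersedes
  `…_of_ge_nine_twentyfifths`), and `dyadicBreakBelowOne_of_belowQuarter` — what is left of 24644: `ε₀ ∈ (0, 1/4)`;
* `kpRelabel_chain_shellBarrierAt_quarter` — the KP chain placed on ANY component (`β = c·dyadicTable ∘ σ`) obeys `ShellBarrierAt R ε₀ β`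
  at every `ε₀ ∈ [1/4, 1]` (relabeling covariance `kpRelabel_shellBarrierAt`; supersedes `kpRelabel_chain_shellBarrierAt`).

HONEST FRAMING: bookkeeping on MODEL lattice ODEs (routes SubOnsagerCeiling / OrthantWake, rung TL-M2Break); corollaries of landed
theorems and reductions between open statements; items 25511 / 24644 stay OPEN (their part `ε₀ < 1/4` contains the λ-uniform
Barbato–Morandin–Romito / Cheskidov–Zaya problem near the continuum limit and is ≥ open in print); no stub, crux or summit is proved and
nothing here bears on Navier–Stokes regularity. [cite: BarbatoMorandinRomito2011, §2 Lemma 2.1 and §3.2]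
[cite: Tao2016AveragedNS, §4 (4.5), (4.13), Thm. 4.2]
-/

noncomputable section

-- the sub-problem namespace `NavierStokesRegularity.NavierStokesRegularity` is the tree's layout (D-0017)
set_option linter.dupNamespace false

namespace Summit.NavierStokesRegularity.NavierStokesRegularity.Theorems

open Set
open Literature.Analysis.FluidPDE.TaoCascade
open Summit.NavierStokesRegularity.NavierStokesRegularity.Theses.SubOnsagerCeiling
open Summit.NavierStokesRegularity.NavierStokesRegularity.Theorems.SubOnsagerCeiling

/-! ## Item 25511 `DyadicTailCeiling` on `[1/4, 1]` -/

/-- **`DyadicTailCeiling` (item stmt-25511) holds at EVERY scale ratio `1+ε₀ ∈ [5/4, 2]`** — the body of the route decl at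
every `ε₀ ∈ [1/4, 1]`, from the chain rungs glued down to `b = 5/4` (`dyadicGapRange21Wide_shellBarrierAt`: `θ = 101/200`,
`D = 100` on every slice, uniformly in `ν > 0`). What remains of the item is `ε₀ ∈ (0, 1/4)` (`dyadicTailCeiling_of_belowQuarter`).
MODEL lattice statement. [cite: BarbatoMorandinRomito2011, §2 Lemma 2.1 and §3.2] -/
theorem dyadicTailCeilingAt_quarterRatio : ∀ ε₀ : ℝ, (1 : ℝ) / 4 ≤ ε₀ → ε₀ ≤ 1 →
    ∃ θ : ℝ, 1 / 2 < θ ∧ ∃ C : ℝ, 0 ≤ C ∧ ∀ ν : ℝ, 0 < ν → ∀ (X₀ : Fin 4 → ℝ) (s : ℝ), 0 < s →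
      ∀ X : Fin 4 → ℤ → ℝ → ℝ, (∀ (i : Fin 4) (k : ℤ), X i k 0 = if k = 0 then X₀ i else 0) →
      (∀ (i : Fin 4) (k : ℤ), k < 0 → ∀ t : ℝ, X i k t = 0) →
      (∃ M : ℝ, ∀ (t : ℝ) (i : Fin 4) (k : ℤ), (1 + (1 + ε₀) ^ ((10 : ℝ) * k)) * |X i k t| ≤ M) →
      (∀ (i : Fin 4) (k : ℤ), Continuous (X i k)) →
      (∀ (i : Fin 4) (k : ℤ), ∀ t ∈ Set.Icc (0 : ℝ) s, HasDerivWithinAt (X i k)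
        (Literature.Analysis.FluidPDE.TaoCascade.quadTerm ε₀ Literature.Analysis.FluidPDE.TaoCascade.dyadicTable X i k t
          - ν * (1 + ε₀) ^ ((2 : ℝ) * k) * X i k t) (Set.Icc (0 : ℝ) s) t) →
      (∀ t ∈ Set.Icc (0 : ℝ) s, ∀ (i : Fin 4) (k : ℤ), 1 ≤ k → 0 ≤ X i k t) →
      ∀ n N : ℕ, n ≤ N → ∀ t ∈ Set.Icc (0 : ℝ) s,
        ∑ k ∈ Finset.Icc n N, ∑ i : Fin 4, (1 / 2 : ℝ) * X i (k : ℤ) t ^ 2 ≤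
          C * (∑ i : Fin 4, (1 / 2 : ℝ) * X₀ i ^ 2) * (1 + ε₀) ^ (-(2 * θ * (n : ℝ))) := by
  intro ε₀ hε hε1
  exact dyadicTailCeilingAt_of_shellBarrierAt (by linarith)
    (fun α hα => dyadicGapRange21Wide_shellBarrierAt 2 ε₀ hε hε1 α hα)

/-- **What is left of item stmt-25511, by name: `DyadicTailCeiling` follows from its part BELOW RATIO `5/4`.**  If the body of
`DyadicTailCeiling` holds at every `ε₀ ∈ (0, 1/4)` — scale ratios `b ∈ (1, 5/4)`, exactly the ratio range of the registered
stub `stub_primaryGradedSmallRatio` of crux 27057 (not reached by the landed certificates and, as `b ↓ 1`, not reachable by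
finitely many certificate slices) — then `DyadicTailCeiling` holds, the range `ε₀ ∈ [1/4, 1]` being `dyadicTailCeilingAt_quarterRatio`.
A reduction between statements; MODEL lattice only. [this file] -/
theorem dyadicTailCeiling_of_belowQuarter
    (h : ∀ ε₀ : ℝ, 0 < ε₀ → ε₀ < (1 : ℝ) / 4 →
      ∃ θ : ℝ, 1 / 2 < θ ∧ ∃ C : ℝ, 0 ≤ C ∧ ∀ ν : ℝ, 0 < ν → ∀ (X₀ : Fin 4 → ℝ) (s : ℝ), 0 < s →
      ∀ X : Fin 4 → ℤ → ℝ → ℝ, (∀ (i : Fin 4) (k : ℤ), X i k 0 = if k = 0 then X₀ i else 0) →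
      (∀ (i : Fin 4) (k : ℤ), k < 0 → ∀ t : ℝ, X i k t = 0) →
      (∃ M : ℝ, ∀ (t : ℝ) (i : Fin 4) (k : ℤ), (1 + (1 + ε₀) ^ ((10 : ℝ) * k)) * |X i k t| ≤ M) →
      (∀ (i : Fin 4) (k : ℤ), Continuous (X i k)) →
      (∀ (i : Fin 4) (k : ℤ), ∀ t ∈ Set.Icc (0 : ℝ) s, HasDerivWithinAt (X i k)
        (Literature.Analysis.FluidPDE.TaoCascade.quadTerm ε₀ Literature.Analysis.FluidPDE.TaoCascade.dyadicTable X i k t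
          - ν * (1 + ε₀) ^ ((2 : ℝ) * k) * X i k t) (Set.Icc (0 : ℝ) s) t) →
      (∀ t ∈ Set.Icc (0 : ℝ) s, ∀ (i : Fin 4) (k : ℤ), 1 ≤ k → 0 ≤ X i k t) →
      ∀ n N : ℕ, n ≤ N → ∀ t ∈ Set.Icc (0 : ℝ) s,
        ∑ k ∈ Finset.Icc n N, ∑ i : Fin 4, (1 / 2 : ℝ) * X i (k : ℤ) t ^ 2 ≤
          C * (∑ i : Fin 4, (1 / 2 : ℝ) * X₀ i ^ 2) * (1 + ε₀) ^ (-(2 * θ * (n : ℝ)))) :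
    DyadicTailCeiling := by
  intro ε₀ h0 hle
  rcases lt_or_ge ε₀ ((1 : ℝ) / 4) with hlt | hge
  · exact h ε₀ h0 hlt
  · exact dyadicTailCeilingAt_quarterRatio ε₀ hge hle

/-! ## Item 24644 `OrthantWake.DyadicBreakBelowOne` on `[1/4, 1)` -/

/-- **`DyadicBreakBelowOne` on `[1/4, 1]`**: for every shell ratio `1+ε₀ ∈ [5/4, 2]` and every one-shell datum `X₀`,
Theorem 4.2-level blow-up fails for the dyadic member: `¬ NoGlobalCascade ε₀ dyadicTable X₀` — the certified shell-barrier range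
`dyadicGapRange21Wide_shellBarrierAt` (`θ = 101/200 > 1/2`, uniformly in `ν`) through `dyadicBreakBelowOne_on_of_shellBarrierAt`.
MODEL lattice statement; `ε₀ < 1/4` remains open. [cite: Tao2016AveragedNS, §4 Thm. 4.2] -/
theorem not_noGlobalCascade_dyadicTable_of_ge_quarter {ε₀ : ℝ} (h₁ : 1 / 4 ≤ ε₀)
    (h₂ : ε₀ ≤ 1) (X₀ : Fin 4 → ℝ) : ¬ NoGlobalCascade ε₀ dyadicTable X₀ :=
  dyadicBreakBelowOne_on_of_shellBarrierAt (by norm_num) dyadicGapRange21Wide_shellBarrierAt ε₀ h₁ h₂ X₀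

/-- Item 24644's shape on the certified range: `∀ ε₀ ∈ [1/4, 1), ∀ X₀, ¬ NoGlobalCascade ε₀ dyadicTable X₀`
(supersedes `dyadicBreakBelowOne_of_ge_nine_twentyfifths`). MODEL lattice statement. [cite: Tao2016AveragedNS, §4 Thm. 4.2] -/
theorem dyadicBreakBelowOne_of_ge_quarter :
    ∀ ε₀ : ℝ, 1 / 4 ≤ ε₀ → ε₀ < 1 → ∀ X₀ : Fin 4 → ℝ, ¬ NoGlobalCascade ε₀ dyadicTable X₀ :=
  fun _ h₁ h₂ X₀ => not_noGlobalCascade_dyadicTable_of_ge_quarter h₁ h₂.le X₀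

/-- **What is left of item stmt-24644, by name: `DyadicBreakBelowOne` follows from its part BELOW RATIO `5/4`.**  If
`¬ NoGlobalCascade ε₀ dyadicTable X₀` holds for every `ε₀ ∈ (0, 1/4)` and every datum, then it holds at every `ε₀ ∈ (0, 1)`, the
range `[1/4, 1)` being `dyadicBreakBelowOne_of_ge_quarter`. A reduction between statements; MODEL lattice only. [this file] -/
theorem dyadicBreakBelowOne_of_belowQuarter
    (h : ∀ ε₀ : ℝ, 0 < ε₀ → ε₀ < 1 / 4 → ∀ X₀ : Fin 4 → ℝ, ¬ NoGlobalCascade ε₀ dyadicTable X₀) :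
    ∀ ε₀ : ℝ, 0 < ε₀ → ε₀ < 1 → ∀ X₀ : Fin 4 → ℝ, ¬ NoGlobalCascade ε₀ dyadicTable X₀ := by
  intro ε₀ h0 h1 X₀
  rcases lt_or_ge ε₀ (1 / 4) with hlt | hge
  · exact h ε₀ h0 hlt X₀
  · exact dyadicBreakBelowOne_of_ge_quarter ε₀ hge h1 X₀

/-! ## The Katz–Pavlović chain on any component, `ε₀ ∈ [1/4, 1]` -/

/-- **The KP chain on ANY component obeys the ν-uniform shell barrier at every `b ∈ [5/4, 2]`**: if
`β i₁ i₂ i₃ μ = c·dyadicTable (σ i₁) (σ i₂) (σ i₃) μ` (`c > 0`; the chain sits on component `σ⁻¹ 0`), then `ShellBarrierAt R ε₀ β`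
for every `R` and every `ε₀ ∈ [1/4, 1]` — `dyadicGapRange21Wide_shellBarrierAt` (placement on component `0`) transported by the
relabeling covariance `kpRelabel_shellBarrierAt` (supersedes `kpRelabel_chain_shellBarrierAt`, `[9/25, 1]`).
[cite: BarbatoMorandinRomito2011, §2 Lemma 2.1 and §3.2] -/
theorem kpRelabel_chain_shellBarrierAt_quarter {β : Fin 4 → Fin 4 → Fin 4 → ℤ × ℤ × ℤ → ℝ} (σ : Equiv.Perm (Fin 4))
    {c : ℝ} (hc : 0 < c) (hβ : ∀ i₁ i₂ i₃ μ, β i₁ i₂ i₃ μ = c * dyadicTable (σ i₁) (σ i₂) (σ i₃) μ) :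
    ∀ R : ℝ, ∀ ε₀ : ℝ, (1 : ℝ) / 4 ≤ ε₀ → ε₀ ≤ 1 → ShellBarrierAt R ε₀ β :=
  fun R ε₀ h1 h2 =>
    kpRelabel_shellBarrierAt σ (α := fun i₁ i₂ i₃ μ => c * dyadicTable i₁ i₂ i₃ μ) hβ
      (dyadicGapRange21Wide_shellBarrierAt R ε₀ h1 h2 _ ⟨c, hc, fun _ _ _ _ => rfl⟩)

end Summit.NavierStokesRegularity.NavierStokesRegularity.Theorems

end
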